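import Summits.ResolutionOfSingularities.ResolutionOfSingularities.Theorems.HilbertSamuelEliminationSigmaMaxModificationsCorridor3ChainTower
import Summits.ResolutionOfSingularities.ResolutionOfSingularities.Theorems.HilbertSamuelEliminationSigmaMaxModificationsCorridor3ReachesCyclePackage
import HarnessLib

/-!
# [OURS · L1 W4.2] The blow-up tower of a chain FROM A MAXIMAL ORIGIN: radical / regular / permissible centres and the setting,
# discharged from the cycle package (sibling of `…Corridor3ChainTower.lean`; crux chain w42, line `w_ladder` v6)

OURS (cell res-hironaka, slot W4.2, LEAD PROVER res-L1-w42-lead-1 gen 3); NOT statements of H. Hironaka's manuscript [Hironaka2017]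
nor of [CossartJannsenSaito2020]; AI proving, weaker than expert review. `--supports stmt-ResolutionOfSingularities-19249`.

PROVED (no named fact): along a chain of canonical near steps from a stage carrying `Helpers.CycleInv` (`ν ≠ Φ^{(N)}`, admissible
oracle) — `cycleInv_chain`; `chainCentre_package` (the chain's centres are REGULAR, lie in the `ν`-strata, are PERMISSIBLE, and `H^N`
does not increase along their blow-ups: `Helpers.CycleInv.centre`, p503609); `chainCentre_eq_vanishingIdeal_support` (the centres are
RADICAL — the hypothesis `hrad` of `Helpers.chainTower` DISCHARGED); `chainTowerOfCycleInv` (the CJS `BlowupTower` of the chain),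
`isPermissible_centreIdeal_chainTowerOfCycleInv`, `keySetting_chainTowerOfCycleInv` (`X_0` excellent, `dim ≤ N`), and
`exists_chainTower_of_isMaximalOrigin` (from `MarkedStage.init X x` at a maximal origin: a tower with permissible centres, `KeySetting`,
and the marked points NEAR over `x`). This is the entry datum of the F-key sockets `Moving.Bridge3M` / `Bridge3SeqM` /
`UnitTowerExtractionQM` (which conclude `∃ T : BlowupTower, KeySetting T 3 ∧ …`), before localisation (res-type-053
`BlowupTowerLocalize`) and compression of waiting steps (CHAIN v3.8 (B-2)).

## References

* V. Cossart, U. Jannsen, S. Saito, LNM 2270 (2020), Def. 6.34 (6.25), Rem. 6.29 (1), Lemma 5.34 (3), Thm. 3.3. [CossartJannsenSaito2020]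
-/

noncomputable section

set_option linter.dupNamespace false -- mandated namespace of this single-conjunct summit

open CategoryTheory AlgebraicGeometry TopologicalSpace Topology
open Literature.AlgebraicGeometry.Resolution Literature.RingTheory.HilbertSamuel
open Literature.AlgebraicGeometry.CossartJannsenSaito2020
open Summit.ResolutionOfSingularities.ResolutionOfSingularities.Theorems.CampaignW42
open Summit.ResolutionOfSingularities.ResolutionOfSingularities.Theorems.SigmaMaxModificationsCorridor3.Moving

namespace Summit.ResolutionOfSingularities.ResolutionOfSingularities.Theorems.SigmaMaxModificationsCorridor3.Helpers

universe u

variable {R : ∀ S : Scheme.{u}, CentreSeq S → Prop} {N : ℕ} {ν : ℕ → ℕ}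

/-! ## From a maximal origin: the cycle invariant supplies radical, regular, permissible centres and the setting -/

section FromOrigin

variable {k : Type u} [Field k] {c : ℕ → MarkedStage.{u}} (hstep : ∀ n, CanonicalNearStep R N ν (c n) (c (n + 1)))

include hstep in
/-- The cycle invariant propagates along the chain. [folklore] -/
theorem cycleInv_chain (hRa : OracleAdmissible R) (hν : ν ≠ iterPSum N Phi) (h0 : CycleInv k N ν (c 0)) (n : ℕ) :
    CycleInv k N ν (c n) := by
  induction n with
  | zero => exact h0
  | succ n ih => exact ih.step hRa hν (hstep n)

/-- **The chain's centres are regular, in the strata, permissible, and `H^N` does not increase along their blow-ups**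
(`CycleInv.centre`). [cite: CossartJannsenSaito2020, Rem. 6.29 (1), Lemma 5.34 (3), Thm. 3.3] -/
theorem chainCentre_package (hRa : OracleAdmissible R) (hν : ν ≠ iterPSum N Phi) (h0 : CycleInv k N ν (c 0)) (n : ℕ) :
    Literature.AlgebraicGeometry.Resolution.Scheme.IsRegular (chainCentre hstep n).subscheme ∧
      ((chainCentre hstep n).support : Set (c n).W) ⊆ Scheme.hsStratum (c n).W N ν ∧
      IdealSheafData.IsPermissible (chainCentre hstep n) ∧
      ∀ z : ↥(blowup (chainCentre hstep n)),
        Scheme.hsFun (blowup (chainCentre hstep n)) N z ≤ Scheme.hsFun (c n).W N ((blowup.π (chainCentre hstep n)).base z) := by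
  obtain ⟨P', hcs⟩ := isCanonicalStep_chainCentre hstep n
  obtain ⟨h1, h2, h3, h4, -⟩ := (cycleInv_chain hstep hRa hν h0 n).centre hRa hν hcs
  exact ⟨h1, h2, h3, h4⟩

/-- The chain's centres are RADICAL (the hypothesis `hrad` of `chainTower`, discharged). [folklore] -/
theorem chainCentre_eq_vanishingIdeal_support (hRa : OracleAdmissible R) (hν : ν ≠ iterPSum N Phi)
    (h0 : CycleInv k N ν (c 0)) (n : ℕ) :
    chainCentre hstep n = Scheme.IdealSheafData.vanishingIdeal (chainCentre hstep n).support :=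
  eq_vanishingIdeal_support_of_isRegular_subscheme _ (chainCentre_package hstep hRa hν h0 n).1

/-- [OURS · L1 W4.2] **THE TOWER OF A CHAIN FROM A STAGE CARRYING THE CYCLE INVARIANT** (`ν ≠ Φ^{(N)}`, admissible oracle):
`chainTower` with the radicality of the centres discharged. [cite: CossartJannsenSaito2020, Def. 6.34] -/
def chainTowerOfCycleInv (hRa : OracleAdmissible R) (hν : ν ≠ iterPSum N Phi) (h0 : CycleInv k N ν (c 0)) : BlowupTower.{u} :=
  chainTower hstep (chainCentre_eq_vanishingIdeal_support hstep hRa hν h0)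

/-- Its centres are permissible (CJS Def. 3.1). [cite: CossartJannsenSaito2020, Lemma 5.34 (3), Thm. 3.3] -/
theorem isPermissible_centreIdeal_chainTowerOfCycleInv (hRa : OracleAdmissible R) (hν : ν ≠ iterPSum N Phi)
    (h0 : CycleInv k N ν (c 0)) (n : ℕ) :
    IdealSheafData.IsPermissible ((chainTowerOfCycleInv hstep hRa hν h0).centreIdeal n) := by
  unfold chainTowerOfCycleInv
  rw [centreIdeal_chainTower]
  exact (chainCentre_package hstep hRa hν h0 n).2.2.1

/-- Its setting: `X_0` excellent (finite type over a field) and `dim X_0 ≤ N`. [cite: CossartJannsenSaito2020, Thm. 6.28 (setting)] -/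
theorem keySetting_chainTowerOfCycleInv (hRa : OracleAdmissible R) (hν : ν ≠ iterPSum N Phi) (h0 : CycleInv k N ν (c 0)) :
    KeySetting (chainTowerOfCycleInv hstep hRa hν h0) N := by
  obtain ⟨⟨f, hf, -⟩, -, hdim, -⟩ := h0
  haveI := hf
  exact keySetting_chainTower hstep _ (Scheme.isExcellent_of_locallyOfFiniteType Stacks07QW_field_holds f) hdim

/-- **From a maximal origin** (`ν ≠ Φ^{(N)}`): a chain of canonical near steps starting AT `MarkedStage.init X x` has its tower, with
permissible centres, `KeySetting`, and marked points near over `x`. [cite: CossartJannsenSaito2020, Def. 6.34, Rem. 6.29 (1)] -/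
theorem exists_chainTower_of_isMaximalOrigin (hRa : OracleAdmissible R) (hν : ν ≠ iterPSum N Phi) {p : ℕ} {X : Scheme.{u}}
    [IsLocallyNoetherian X] {x : X} (hX : IsMaximalOrigin p N ν X x) (hc0 : c 0 = MarkedStage.init X x) :
    ∃ (k : Type u) (_ : Field k) (h0 : CycleInv k N ν (c 0)),
      KeySetting (chainTowerOfCycleInv hstep hRa hν h0) N ∧
      (∀ n, IdealSheafData.IsPermissible ((chainTowerOfCycleInv hstep hRa hν h0).centreIdeal n)) ∧
      ∀ n, (c n).pt ∈ (chainTowerOfCycleInv hstep hRa hν h0).nearLocus N (c 0).pt n := by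
  obtain ⟨k, _, h0⟩ := CycleInv.init (N := N) (ν := ν) hX
  rw [← hc0] at h0
  refine ⟨k, inferInstance, h0, keySetting_chainTowerOfCycleInv hstep hRa hν h0,
    isPermissible_centreIdeal_chainTowerOfCycleInv hstep hRa hν h0, fun n => ?_⟩
  have hmem : (c 0).pt ∈ Scheme.hsStratum (c 0).W N ν := by rw [hc0]; exact hX.mem_stratum
  exact pt_mem_nearLocus_chainTower hstep _ hmem n

end FromOrigin

end Summit.ResolutionOfSingularities.ResolutionOfSingularities.Theorems.SigmaMaxModificationsCorridor3.Helpers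

end
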